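import Summits.CriticalPhenomena.SAWScalingLimit.Theses.SAWResidueField
import Summits.CriticalPhenomena.SAWScalingLimit.Theorems.SAWMassiveIsingTiltLatticeUniversalityKernelUnderTransport
import Summits.CriticalPhenomena.SAWScalingLimit.Theorems.SAWMassiveIsingTiltLatticeUniversalityKernelPinned
import Summits.CriticalPhenomena.SAWScalingLimit.Theorems.SAWDevelopingMapHexTransferThirdBdryEndpoints
import Literature.Probability.RandomPlanarGeometry.YangBaxterSAWLaw
import Literature.Probability.RandomPlanarGeometry.ChordalCurveFamily
import HarnessLib

/-!
# Sketch (crux-strategist s2, 2026-08-17): the route-level split of `LatticeUniversality` (stmt-CriticalPhenomena-0807)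
# on route SAWResidueField, typed exactly as the gate would render the children, with the glue PROVED from the
# landed composition `latticeUniversality_of_vcr_robustSquare` (p161241, lead c4) — children 2–4 are the SAWTrackTransport
# items stmt-16995 / 16963 / 16966 VERBATIM (dedup by signature), child 1 is VCR = registered stub `stub_hexVertexRobust`.
-/

namespace Summit.CriticalPhenomena.SAWScalingLimit.Theses.SAWResidueField

open scoped BigOperators Topology Manifold Classical MeasureTheory ProbabilityTheory Matrix InnerProductSpace ComplexConjugate ContinuousMap
open Filter Set Function TopologicalSpace MeasureTheory

/-- child 1 (crux, research): VCR — vertex-convention robustness of the Glazman–Manolescu `π/3` robust limit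
(= registered stub `stub_hexVertexRobust` of skeleton v4.1, body verbatim with qualified names). -/
def HexVertexRobust : Prop :=
  open MeasureTheory Filter Literature.Probability.RandomPlanarGeometry Literature.Probability.RandomPlanarGeometry.SAW.YangBaxter in ∀ P : ChordalFamily, P.IsChordal → (∀ (D : DobrushinDomain) (u : ℝ → ℂ) (a b : ℝ → MidEdge), (∀ᶠ δ in 𝓝[>] (0 : ℝ), ‖u δ‖ ≤ δ) → (∀ᶠ δ in 𝓝[>] (0 : ℝ), Nonempty (YangBaxterSAW (fun (_ : ℤ) => Real.pi / 3) ((D.map (similarity 1 one_ne_zero (u δ))).carrier) δ (a δ) (b δ))) → Tendsto (fun δ : ℝ => (δ : ℂ) * planeMidpoint (fun (_ : ℤ) => Real.pi / 3) (a δ)) (𝓝[>] (0 : ℝ)) (𝓝 (D.pt 0)) → Tendsto (fun δ : ℝ => (δ : ℂ) * planeMidpoint (fun (_ : ℤ) => Real.pi / 3) (b δ)) (𝓝[>] (0 : ℝ)) (𝓝 (D.pt 1)) → TendstoLaw (fun δ (γ : YangBaxterSAW (fun (_ : ℤ) => Real.pi / 3) ((D.map (similarity 1 one_ne_zero (u δ))).carrier)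 δ (a δ) (b δ)) => γ.curve (fun (_ : ℤ) => Real.pi / 3) δ) (fun δ => ybLaw (fun (_ : ℤ) => Real.pi / 3) ((D.map (similarity 1 one_ne_zero (u δ))).carrier) δ 1 (a δ) (b δ)) id (P D)) → ∀ (D : DobrushinDomain) (a b : ℝ → Literature.Probability.LatticeModels.HexVertex), SAW.IsEmbEndpointApprox Literature.Probability.LatticeModels.hexGraph Literature.Probability.LatticeModels.hexCenter D a b → TendstoLaw (fun δ (γ : SAW.HexDomainSAW D.carrier δ (a δ) (b δ)) => CurveClass.map (similarity Complex.I Complex.I_ne_zero 0 : C(ℂ, ℂ)) γ.curve) (fun δ => SAW.hexSAWLaw D.carrier δ (a δ) (b δ)) id (P (D.map (similarity Complex.I Complex.I_ne_zero 0)))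

/-- child 2 (crux) = item stmt-CriticalPhenomena-16995 `SAWTrackTransport.YBLimitExists` VERBATIM. -/
def YBLimitExists : Prop :=
  open MeasureTheory Filter Literature.Probability.RandomPlanarGeometry Literature.Probability.RandomPlanarGeometry.SAW.YangBaxter in let RL : ℝ → ChordalFamily → Prop := fun α P => ∀ (D : DobrushinDomain) (u : ℝ → ℂ) (a b : ℝ → MidEdge), (∀ᶠ δ in 𝓝[>] (0 : ℝ), ‖u δ‖ ≤ δ) → (∀ᶠ δ in 𝓝[>] (0 : ℝ), Nonempty (YangBaxterSAW (fun (_ : ℤ) => α) ((D.map (similarity 1 one_ne_zero (u δ))).carrier) δ (a δ) (b δ))) → Tendsto (fun δ : ℝ => (δ : ℂ) * planeMidpoint (fun (_ : ℤ) => α) (a δ)) (𝓝[>] (0 : ℝ)) (𝓝 (D.pt 0)) → Tendsto (fun δ : ℝ => (δ : ℂ) * planeMidpoint (fun (_ : ℤ) => α) (b δ)) (𝓝[>] (0 : ℝ)) (𝓝 (D.pt 1)) → TendstoLaw (fun δ (γ : YangBaxterSAW (fun (_ : ℤ) => α) ((D.map (similarity 1 one_ne_zero (u δ))).carrier) δ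 (a δ) (b δ)) => γ.curve (fun (_ : ℤ) => α) δ) (fun δ => ybLaw (fun (_ : ℤ) => α) ((D.map (similarity 1 one_ne_zero (u δ))).carrier) δ 1 (a δ) (b δ)) id (P D); (∀ α ∈ Set.Icc (Real.pi / 3) (2 * Real.pi / 3), ∀ D : DobrushinDomain, ∃ a b : ℝ → MidEdge, IsYBEndpointApprox (fun (_ : ℤ) => α) D a b) ∧ ∃ P : ChordalFamily, P.IsChordal ∧ RL (Real.pi / 2) P

/-- child 3 (crux) = item stmt-CriticalPhenomena-16963 `SAWTrackTransport.AngleUniversality` VERBATIM. -/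
def AngleUniversality : Prop :=
  open MeasureTheory Filter Literature.Probability.RandomPlanarGeometry Literature.Probability.RandomPlanarGeometry.SAW.YangBaxter in let RL : ℝ → ChordalFamily → Prop := fun α P => ∀ (D : DobrushinDomain) (u : ℝ → ℂ) (a b : ℝ → MidEdge), (∀ᶠ δ in 𝓝[>] (0 : ℝ), ‖u δ‖ ≤ δ) → (∀ᶠ δ in 𝓝[>] (0 : ℝ), Nonempty (YangBaxterSAW (fun (_ : ℤ) => α) ((D.map (similarity 1 one_ne_zero (u δ))).carrier) δ (a δ) (b δ))) → Tendsto (fun δ : ℝ => (δ : ℂ) * planeMidpoint (fun (_ : ℤ) => α) (a δ)) (𝓝[>] (0 : ℝ)) (𝓝 (D.pt 0)) → Tendsto (fun δ : ℝ => (δ : ℂ) * planeMidpoint (fun (_ : ℤ) => α) (b δ)) (𝓝[>] (0 : ℝ)) (𝓝 (D.pt 1)) → TendstoLaw (fun δ (γ : YangBaxterSAW (fun (_ : ℤ) => α) ((D.map (similarity 1 one_ne_zero (u δ))).carrier) δ (a δ) (b δ)) => γ.curve (fun (_ : ℤ) => α) δ) (fun δ => ybLaw (fun (_ : ℤ) =>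 α) ((D.map (similarity 1 one_ne_zero (u δ))).carrier) δ 1 (a δ) (b δ)) id (P D); ∀ α ∈ Set.Icc (Real.pi / 3) (2 * Real.pi / 3), ∀ P : ChordalFamily, P.IsChordal → RL (Real.pi / 2) P → RL α P

/-- child 4 (crux) = item stmt-CriticalPhenomena-16966 `SAWTrackTransport.YBtoUniform` VERBATIM. -/
def YBtoUniform : Prop :=
  open MeasureTheory Filter Literature.Probability.RandomPlanarGeometry Literature.Probability.RandomPlanarGeometry.SAW.YangBaxter in ∀ (D : DobrushinDomain) (a b : ℝ → Literature.Probability.LatticeModels.Site 2) (a' b' : ℝ → MidEdge), SAW.IsEndpointApprox D a b → IsYBEndpointApprox (fun (_ : ℤ) => Real.pi / 2) D a' b' → ∀ f : BoundedContinuousFunction (CurveClass ℂ) ℝ, Tendsto (fun δ : ℝ => (∫ γ, f γ.curve ∂(SAW.law D.carrier δ (a δ) (b δ))) - ∫ γ, f (γ.curve (fun (_ : ℤ) => Real.pi / 2) δ) ∂(ybLaw (fun (_ : ℤ) => Real.pi / 2) D.carrier δ 1 (a' δ) (b' δ))) (𝓝[>] (0 : ℝ)) (𝓝 0)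

/-- the glue item of the split (support): children ⟹ parent. -/
def LatticeUniversalityGlue : Prop :=
  HexVertexRobust → YBLimitExists → AngleUniversality → YBtoUniform → LatticeUniversality

/-- THE GLUE IS PROVED (one line over the landed composition of skeleton v4.1, p161241). -/
theorem latticeUniversalityGlue_proof : LatticeUniversalityGlue :=
  fun hV h95 hAU hT =>
    Summit.CriticalPhenomena.SAWScalingLimit.Cruxes.LatticeUniversality.Birth.latticeUniversality_of_vcr_robustSquare
      hV h95.2 hAU hT

/-- dedup sanity: child 2 IS stmt-16995. -/
theorem ybLimitExists_iff : YBLimitExists ↔ SAWTrackTransport.YBLimitExists := Iff.rfl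
/-- dedup sanity: child 3 IS stmt-16963. -/
theorem angleUniversality_iff : AngleUniversality ↔ SAWTrackTransport.AngleUniversality := Iff.rfl
/-- dedup sanity: child 4 IS stmt-16966. -/
theorem ybToUniform_iff : YBtoUniform ↔ SAWTrackTransport.YBtoUniform := Iff.rfl
/-- stub ↔ item sanity: the skeleton's stub 2 (`stub_ybRobustLimit` = 16995 (ii), statement verbatim) follows from child 2. -/
theorem robustSquareLimit_of_child2 (h : YBLimitExists) :
    (open MeasureTheory Filter Literature.Probability.RandomPlanarGeometry Literature.Probability.RandomPlanarGeometry.SAW.YangBaxter in ∃ P : ChordalFamily, P.IsChordal ∧ ∀ (D : DobrushinDomain) (u : ℝ → ℂ) (a b : ℝ → MidEdge), (∀ᶠ δ in 𝓝[>] (0 : ℝ), ‖u δ‖ ≤ δ) → (∀ᶠ δ in 𝓝[>] (0 : ℝ), Nonempty (YangBaxterSAW (fun (_ : ℤ) => Real.pi / 2) ((D.map (similarity 1 one_ne_zero (u δ))).carrier) δ (a δ) (b δ))) → Tendsto (fun δ : ℝ => (δ : ℂ) * planeMidpoint (fun (_ : ℤ) => Real.pi / 2) (a δ)) (𝓝[>]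 (0 : ℝ)) (𝓝 (D.pt 0)) → Tendsto (fun δ : ℝ => (δ : ℂ) * planeMidpoint (fun (_ : ℤ) => Real.pi / 2) (b δ)) (𝓝[>] (0 : ℝ)) (𝓝 (D.pt 1)) → TendstoLaw (fun δ (γ : YangBaxterSAW (fun (_ : ℤ) => Real.pi / 2) ((D.map (similarity 1 one_ne_zero (u δ))).carrier) δ (a δ) (b δ)) => γ.curve (fun (_ : ℤ) => Real.pi / 2) δ) (fun δ => ybLaw (fun (_ : ℤ) => Real.pi / 2) ((D.map (similarity 1 one_ne_zero (u δ))).carrier) δ 1 (a δ) (b δ)) id (P D)) :=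
  h.2


/-- stub ↔ item sanity, converse: conjunct (i) of stmt-16995 is LANDED (`ybEndpoints_of_mem_Icc`,
Theorems/SAWDevelopingMapHexTransferThirdBdryEndpoints.lean), so child 2 is EQUIVALENT to the registered stub 2 (16995 (ii)). -/
theorem child2_of_robustSquareLimit
    (h : open MeasureTheory Filter Literature.Probability.RandomPlanarGeometry Literature.Probability.RandomPlanarGeometry.SAW.YangBaxter in ∃ P : ChordalFamily, P.IsChordal ∧ ∀ (D : DobrushinDomain) (u : ℝ → ℂ) (a b : ℝ → MidEdge), (∀ᶠ δ in 𝓝[>] (0 : ℝ), ‖u δ‖ ≤ δ) → (∀ᶠ δ in 𝓝[>] (0 : ℝ), Nonempty (YangBaxterSAW (fun (_ : ℤ) => Real.pi / 2) ((D.map (similarity 1 one_ne_zero (u δ))).carrier) δ (a δ) (b δ))) → Tendsto (fun δ : ℝ => (δ : ℂ) * planeMidpoint (fun (_ : ℤ) => Real.pi / 2) (a δ)) (𝓝[>] (0 : ℝ)) (𝓝 (D.pt 0)) → Tendsto (fun δ : ℝ => (δ : ℂ) * planeMidpoint (fun (_ : ℤ) => Real.pi / 2) (b δ)) (𝓝[>]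 (0 : ℝ)) (𝓝 (D.pt 1)) → TendstoLaw (fun δ (γ : YangBaxterSAW (fun (_ : ℤ) => Real.pi / 2) ((D.map (similarity 1 one_ne_zero (u δ))).carrier) δ (a δ) (b δ)) => γ.curve (fun (_ : ℤ) => Real.pi / 2) δ) (fun δ => ybLaw (fun (_ : ℤ) => Real.pi / 2) ((D.map (similarity 1 one_ne_zero (u δ))).carrier) δ 1 (a δ) (b δ)) id (P D)) :
    YBLimitExists :=
  ⟨Summit.CriticalPhenomena.SAWScalingLimit.Cruxes.HexTransfer.YbRelay.ybEndpoints_of_mem_Icc, h⟩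

/-- converse direction recorded (c5, KernelPinned p16xxxx): granted children 2–4 the parent gives child 1 back,
so the split is TIGHT (no slack) — `latticeUniversality_iff_hexVertexRobust`. -/
theorem child1_of_parent (hU : LatticeUniversality) (h95 : YBLimitExists) (hAU : AngleUniversality) (hT : YBtoUniform) :
    HexVertexRobust :=
  Summit.CriticalPhenomena.SAWScalingLimit.Cruxes.LatticeUniversality.Birth.hexVertexRobust_of_latticeUniversality hU h95.2 hAU hT

#print axioms latticeUniversalityGlue_proof

end Summit.CriticalPhenomena.SAWScalingLimit.Theses.SAWResidueField
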